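import Literature.IUT.HodgeTheaters.PMBaseNegCompatProofs
import Literature.IUT.HodgeTheaters.PMBaseEx63ConsistencyProofs

/-!
# [IUTchI] Ex 6.3 (ii) / Prop 6.6 (ii)(iii) / Prop 6.8 (i): the `[−1]`-compatibility of `φ^{Θell}_{•,v}`, NAMED (sub-DAG statements file)

Statements-first sub-DAG file (abc-iut cell, D-0068 (1); seat abc-iut-w5-d086, holder of
«SUBDAG IUTchI:Prop6.5(i)(iv)+Prop6.6(iii)(v)» per abc-iut-L5-lead 2026-08-26T00:17:50Z / 00:18:27Z (a):
"your sub-DAG … has exactly ONE residual prover row: «negCompat for the PRINTED model kit» … state it over the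
Ex 6.2 model objects … as `def NegCompatModel : Prop` + locus"). Index: plan/L5/SUBDAG-IUTchI-Prop65-Prop66.md
(row P65-L04 = this statement; row P66-L04 consumes it).

S. Mochizuki, *Inter-universal Teichmüller theory I*, kurims manuscript (May 2020) §6: Example 6.2 (ii)(iii)
pp. 159–160 (the poly-automorphisms `−1_{𝔽_l}` and `α^{Θ±}`, `α ∈ {±1}^𝕍`, of `(𝔇_±, 𝔇_≻, φ^{Θ±}_±)`),
Example 6.3 (ii) p. 161 ("one verifies immediately that `φ^{Θell}_±` is equivariant with respect to these
poly-actions of `𝔽_l^{⋊±}` on `𝔇_±` and `𝒟^{⊚±}`"), Definition 6.1 (v) p. 158 / Remark 6.1.1 (the action of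
`Aut_±(𝒟^{⊚±})/Aut_csp(𝒟^{⊚±}) ≅ 𝔽_l^{⋊±}` on `LabCusp^±(𝒟^{⊚±})`). Claim key `Mochizuki2012`, status DISPUTED
(D-0012). Nothing here takes a side on [IUTchIII] Cor. 3.12; typed ≠ proved.

WHAT IS NAMED. abc-iut-L5-t13 proved Ex 6.3 (ii) for POSITIVE `γ` over every base kit
(`Ex63.equivariant_of_isPositive`), certified that for NEGATIVE `γ` it is NOT derivable from the frozen base
interface `PMBaseKit` (`Ex63.exists_kit_not_equivariant`, p407937), and REDUCED the negative half to ONE kit-shaped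
condition (`Ex63.equivariant_of_negCompat`, p410816), which abc-iut-w4-d073 showed to be SATISFIABLE with every
interface clause (`Ex63.negCompat_toyKit`, p412686). That condition was carried INLINE (as the binder `hneg` /
`hE`) by the conditional discharges of Prop 6.6 (ii), (iii), 6.8 (i), Rmk 6.12.1. Here it receives a NAME over
the Example 6.2 / 6.3 model objects of `PMBaseModels.lean` (abc-iut-L5-t4, BUILT): `Ex63.NegCompatModel K` —
"at every `v ∈ 𝕍` some NEGATIVE automorphism of the model `𝒟`-prime-strip constituent `𝒟_v` (one acting by
`−1` on `LabCusp^±(𝒟_v)`, Ex 6.2 (iii)) is intertwined by `φ^{Θell}_{•,v} : 𝒟_v → 𝒟^{⊚±}` with a lift to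
`Aut_±(𝒟^{⊚±})` of `(0, −1) ∈ 𝔽_l^{⋊±}`" — a PREDICATE on the kit (vocabulary with a parameter, NOT a 0-ary
Prop fact; the FACT-LIST row F-2027 «conditional: negative γ» is exactly this clause). It is the ONE sub-node a
prover (or the L5-internal merge that instantiates `PMBaseKit` from the `𝒟`-prime-strips of Ex 3.2–3.4 /
Def 4.1 / Def 6.1) must supply for the genuine data; the four conditional theorems are restated over it as
one-liners, and its consistency is recorded at abc-iut-L5-t4's `toyKit`.
-/

namespace Literature.IUT.HodgeTheaters

open CategoryTheory

universe u

namespace PMBaseKit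

variable {l : ℕ}

namespace Ex63

/-- **[IUTchI] Ex 6.3 (ii), negative elements — the `[−1]`-compatibility of `φ^{Θell}_{•,v}` at the model**
(p. 161 "one verifies immediately that `φ^{Θell}_±` is equivariant with respect to these poly-actions of
`𝔽_l^{⋊±}`", read for `γ = (0, −1)` through Ex 6.2 (ii)/(iii) pp. 159–160 and Def 6.1 (v)): for every `v ∈ 𝕍`
there are a NEGATIVE automorphism `a` of the model constituent `𝒟_v` — `LabCusp^±(a) = −1` — and a lift
`b ∈ Aut_±(𝒟^{⊚±})` of `(0, −1) ∈ 𝔽_l^{⋊±}` with `a ≫ φ^{Θell}_{•,v} = φ^{Θell}_{•,v} ≫ b`. Geometrically: the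
inversion of the elliptic curve underlying `X_K` fixes the cusp labelled `0` and acts by `−1` on the `±`-label
classes of cusps of `X→_v`. Named PREDICATE on the base kit (sub-DAG row P65-L04; the hypothesis `hneg` of
abc-iut-L5-t13's `Ex63.equivariant_of_negCompat`); NOT derivable from the interface
(`Ex63.exists_kit_not_equivariant`), to be supplied for the genuine kit at the merge.
[claim: Mochizuki2012, status: disputed] [cite: Mochizuki2012, IUTchI Ex 6.3 (ii) p.161] -/
def NegCompatModel (K : PMBaseKit.{u} l) : Prop :=
  ∀ v, ∃ a : K.model v ≅ K.model v, K.labMap v a = labNeg (K.isLocal_model v) ∧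
    ∃ b ∈ lifts K (FlPM.mk 0 (-1)), a.hom ≫ K.phiEll v = K.phiEll v ≫ (K.atV v).map b.hom

variable {K : PMBaseKit.{u} l}

/-- **Ex 6.3 (ii) in full from `NegCompatModel`** (p. 161): `φ^{Θell}_±` is equivariant for every NEGATIVE
`γ ∈ 𝔽_l^{⋊±}` (the positive ones are abc-iut-L5-t13's `equivariant_of_isPositive`, unconditional) — i.e. the
binder `hE : ∀ γ, γ.IsNegative → Ex63.Equivariant K γ` of the conditional discharges.
[claim: Mochizuki2012, status: disputed] -/
theorem NegCompatModel.equivariant (h : NegCompatModel K) {γ : FlPM l} (hγ : γ.IsNegative) :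
    Equivariant K γ :=
  equivariant_of_negCompat h hγ

/-- `NegCompatModel` is CONSISTENT with every clause of the base interface: it holds for abc-iut-L5-t4's
`toyKit` (abc-iut-w4-d073's `Ex63.negCompat_toyKit`, pointwise in `v`) — non-vacuity of the sub-DAG row P65-L04.
[claim: Mochizuki2012, status: disputed] [cite: Mochizuki2012, IUTchI Ex 6.3 (ii) p.161] -/
theorem negCompatModel_toyKit (l : ℕ) [Fact l.Prime] (hl : l ≠ 2) : NegCompatModel (toyKit l hl) :=
  fun v => negCompat_toyKit l hl v

end Ex63

variable {K : PMBaseKit.{u} l}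

/-- **[IUTchI] Prop 6.6 (ii)** (p. 165) from `Ex63.NegCompatModel` — abc-iut-L5-t13's
`DThetaEllBridge.isoTorsor_of_negCompat` over the named predicate. [claim: Mochizuki2012, status: disputed] -/
theorem DThetaEllBridge.isoTorsor_of_negCompatModel (h : Ex63.NegCompatModel K) (B₁ B₂ : K.DThetaEllBridge) :
    DThetaEllBridge.IsoTorsor B₁ B₂ :=
  DThetaEllBridge.isoTorsor_of_negCompat h B₁ B₂

/-- **[IUTchI] Prop 6.6 (iii)** (p. 165: "the set of isomorphisms between two `𝒟-Θ^{±ell}`-Hodge theaters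
forms a `{±1}`-torsor … maps bijectively … to the set of isomorphisms of `𝔽_l^±`-groups between the index
sets") from `Ex63.NegCompatModel` — sub-DAG row P66-L04; existence and injectivity are unconditional
(`isoTorsor_nonempty`, `isoTorsor_injective`). [claim: Mochizuki2012, status: disputed] -/
theorem DThetaPMEllHT.isoTorsor_of_negCompatModel (h : Ex63.NegCompatModel K) (H₁ H₂ : K.DThetaPMEllHT) :
    DThetaPMEllHT.IsoTorsor H₁ H₂ :=
  DThetaPMEllHT.isoTorsor_of_negCompat h H₁ H₂

/-- **[IUTchI] Prop 6.8 (i)** (p. 167) from `Ex63.NegCompatModel` — abc-iut-L5-t13's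
`DThetaPMEllHT.ellBridgeSymmetry_of_negCompat` over the named predicate. [claim: Mochizuki2012, status: disputed] -/
theorem DThetaPMEllHT.ellBridgeSymmetry_of_negCompatModel (h : Ex63.NegCompatModel K) (H : K.DThetaPMEllHT) :
    DThetaPMEllHT.EllBridgeSymmetry H :=
  DThetaPMEllHT.ellBridgeSymmetry_of_negCompat h H

end PMBaseKit

end Literature.IUT.HodgeTheaters
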